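import Summits.BirchSwinnertonDyer.BirchSwinnertonDyer.Theorems.LeadingTermPinchPrimeOrderEqRankOfSchneiderShaAt
import Literature.NumberTheory.EllipticCurves.LeadingTerm

/-!
# BirchSwinnertonDyer / LeadingTerm — crux `PinchPrime` (stmt-BirchSwinnertonDyer-16218),
# line `SketchIdeator2`, stub `stub_pinchAt_of_analyticRank_le_one_of_schneiderIO` (KNOWN SLICE:
# analytic rank `≤ 1`)

Registered stub (G7) of the lead skeleton `Cruxes/PinchPrime/Lines/SketchIdeator2.lean` (v12). The
crux `LeadingTerm.PinchPrime` asks, for every elliptic `E/ℚ` (globally minimal `W`), for ONE good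
ordinary prime `p ≥ 5`, a canonical `p`-adic height datum and a newform `f` of `E` with
`ord_{T=0} L_p(f, α_p, T) = rank_ℤ E(ℚ)`. This file proves the instance of the crux for a curve of
analytic rank `≤ 1` whose canonical cyclotomic `p`-adic height is non-degenerate (Schneider's
conjecture) at good ordinary primes `p ≥ 5` outside every finite set, modulo four named facts
taken as hypotheses:
* `Schneider1985_order_charGenerator` (Perrin-Riou–Schneider, as printed in
  Balakrishnan–Müller–Stein, Math. Comp. 85 (2016), Thm. 1.7);
* `burungale_castella_skinner_charIdeal_eq_padicLFunction` (Burungale–Castella–Skinner 2025,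
  Thm. 1.1.2 (a));
* `exists_isNewformOf` (modularity, Breuil–Conrad–Diamond–Taylor 2001);
* `rank_eq_analyticRank_of_analyticRank_le_one` (Gross–Zagier–Kolyvagin, Darmon CBMS 101 (2004),
  Thm. 3.22: `r_an ≤ 1 ⟹ rank = r_an` and `Ш(E/ℚ)` finite).

Proof. GZK makes `Ш(E/ℚ)` finite, hence `Ш(E/ℚ)[p^∞]` finite at every `p`; Silverman *AEC*
Cor. IX.6.3 in cofinite form (`WeierstrassCurve.exists_forall_hasIrreducibleModPGaloisRep_of_lt`,
PROVED) gives `N` with `E[p]` irreducible for all primes `p > N`; the hypothesis applied to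
`B := Finset.range (N + 1)` yields a good ordinary `p ≥ 5`, `p > N`, at which every canonical datum
is non-degenerate; the canonical datum exists (`WeierstrassCurve.exists_isCanonical_holds`,
Mazur–Stein–Tate 2006, PROVED), the newform exists by modularity, and the landed pointwise bridge
`stub_orderEqRankOfSchneiderShaAt` (p134300) concludes. The corollary
`cofiniteShaFinite_of_analyticRank_le_one` records that GZK alone gives the line's open stub (A)
(`Ш[p^∞]` finite cofinitely in `p`) for such curves, with `B = ∅`.
-/

noncomputable section

set_option linter.dupNamespace false

namespace Summit.BirchSwinnertonDyer.BirchSwinnertonDyer.Cruxes.PinchPrime.FirstLayerStability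

open scoped MatrixGroups ModularForm
open CongruenceSubgroup Literature.NumberTheory.EllipticCurves
  Literature.NumberTheory.EllipticCurves.ModularForms
open Summit.BirchSwinnertonDyer.BirchSwinnertonDyer.Theses

/-- **The crux in analytic rank `≤ 1`, given Schneider's conjecture infinitely often** (stub
`stub_pinchAt_of_analyticRank_le_one_of_schneiderIO` of crux `PinchPrime`, line `SketchIdeator2`).
Assume PRS (`Schneider1985_order_charGenerator`), BCS
(`burungale_castella_skinner_charIdeal_eq_padicLFunction`), modularity (`exists_isNewformOf`) and
Gross–Zagier–Kolyvagin (`rank_eq_analyticRank_of_analyticRank_le_one`). Let `E/ℚ` be elliptic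
with globally minimal `W` and `ord_{s=1} L(E, s) ≤ 1`, and suppose that outside every finite set
of naturals there is a good ordinary prime `p ≥ 5` at which every canonical `p`-adic height datum
is non-degenerate. Then there are a good ordinary prime `p ≥ 5`, a canonical datum `D` and a
newform `f` of `E` with `ord_{T=0} L_p(f, α_p, T) = rank_ℤ E(ℚ)`: GZK gives `Ш(E/ℚ)` finite, so
`Ш[p^∞]` is finite at every `p`; choosing `p` beyond the finitely many primes with `E[p]`
reducible (*AEC* Cor. IX.6.3), the pointwise bridge `stub_orderEqRankOfSchneiderShaAt` applies.
[cite: Darmon2004, Thm. 3.22] [cite: BalakrishnanMullerStein2015, Thm. 1.7] -/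
theorem stub_pinchAt_of_analyticRank_le_one_of_schneiderIO :
    Schneider1985_order_charGenerator → burungale_castella_skinner_charIdeal_eq_padicLFunction →
    exists_isNewformOf → rank_eq_analyticRank_of_analyticRank_le_one →
    ∀ (W : WeierstrassCurve ℚ) [W.IsElliptic] [W.IsGloballyMinimal], W.analyticRank ≤ 1 →
      (∀ B : Finset ℕ, ∃ p ∉ B, ∃ _ : Fact p.Prime, 5 ≤ p ∧ IsOrdinaryAt W p ∧
        ∀ Dh : WeierstrassCurve.PAdicHeightData W p, Dh.IsCanonical →
          WeierstrassCurve.SchneiderConjecture Dh) →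
      ∃ (p : ℕ) (_ : Fact p.Prime), 5 ≤ p ∧ IsOrdinaryAt W p ∧
        ∃ (D : WeierstrassCurve.PAdicHeightData W p), D.IsCanonical ∧
          ∃ (N : ℕ) (_ : NeZero N) (f : CuspForm (Gamma0 N) 2), IsNewformOf W f ∧
            (padicLFunction f (unitRoot W p : ℚ_[p])).order = W.mordellWeilRank := by
  intro hPRS hBCS hmod hGZK W _ _ han hIO
  -- GZK: `Ш(E/ℚ)` is finite, hence so is every `p`-primary component
  haveI : Finite W.sha := (hGZK W han).2
  -- a bound beyond which `E[p]` is irreducible (AEC Cor. IX.6.3, cofinite form)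
  obtain ⟨N, hN⟩ := W.exists_forall_hasIrreducibleModPGaloisRep_of_lt
  -- a good ordinary `p ≥ 5` outside `{0, …, N}` with Schneider's conjecture at `p`
  obtain ⟨p, hpB, hp, h5, hord, hSch⟩ := hIO (Finset.range (N + 1))
  have hNp : N < p := by
    have : ¬ p < N + 1 := fun h ↦ hpB (Finset.mem_range.mpr h)
    omega
  have hirr : W.HasIrreducibleModPGaloisRep p := hN p hNp (Fact.out : p.Prime)
  have hsha : Finite (AddCommGroup.primaryComponent W.sha p) := inferInstance
  -- the canonical datum (Mazur–Stein–Tate) and the newform (modularity)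
  obtain ⟨Dh, hDh⟩ := WeierstrassCurve.exists_isCanonical_holds W p h5 hord.1 hord.2
  haveI : NeZero (W.conductorNorm ℤ) := ⟨(WeierstrassCurve.conductorNorm_pos_holds (W := W)).ne'⟩
  obtain ⟨f, hf⟩ := hmod W
  exact ⟨p, hp, h5, hord, Dh, hDh, _, inferInstance, f, hf,
    stub_orderEqRankOfSchneiderShaAt hPRS hBCS W p h5 hord hirr hsha Dh hDh (hSch Dh hDh) f hf⟩

/-- **Open stub (A) in analytic rank `≤ 1`**: assuming Gross–Zagier–Kolyvagin
(`rank_eq_analyticRank_of_analyticRank_le_one`), for an elliptic `E/ℚ` (globally minimal `W`) with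
`ord_{s=1} L(E, s) ≤ 1` the `p`-primary part `Ш(E/ℚ)[p^∞]` is finite at every good ordinary
prime `p` outside a finite set — indeed outside `∅`, since `Ш(E/ℚ)` itself is finite.
[cite: Darmon2004, Thm. 3.22] -/
theorem cofiniteShaFinite_of_analyticRank_le_one :
    rank_eq_analyticRank_of_analyticRank_le_one →
    ∀ (W : WeierstrassCurve ℚ) [W.IsElliptic] [W.IsGloballyMinimal], W.analyticRank ≤ 1 →
      ∃ B : Finset ℕ, ∀ p ∉ B, ∀ [Fact p.Prime], IsOrdinaryAt W p →
        Finite (AddCommGroup.primaryComponent W.sha p) := by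
  intro h W _ _ han
  haveI : Finite W.sha := (h W han).2
  exact ⟨∅, fun p _ _ _ ↦ inferInstance⟩

end Summit.BirchSwinnertonDyer.BirchSwinnertonDyer.Cruxes.PinchPrime.FirstLayerStability

end
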